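import Mathlib
import HarnessLib
import Literature.Analysis.FluidPDE.ClassicalSolution
import Literature.Analysis.FluidPDE.ClassicalSolutionRegion
import Literature.Analysis.FluidPDE.SelfSimilar
import Literature.Analysis.FluidPDE.HyperbolicDSSOrbit

/-!
# Route `QuarterLogPincer` — objects posited by LINE `flat_window` of crux `TypeIQuantSubcubicExp`
  (item stmt-NavierStokesRegularity-24077): the Pineau–Vicol region, the one-slice defect, the profile
  line, and the line's four obligation statements

Definitions ONLY — the route-posited objects of the rung line
`Cruxes/TypeIQuantSubcubicExp/Lines/flat_window.lean` (ns-idea-7 g4, tree sha256/16 `183c0c8f2f447a08`,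
critic idea-crit-7 PASS-WITH-PRICE 2026-08-28T11:13:22Z), copied VERBATIM and only re-homed into an
importable module (crux workfiles under `Cruxes/` are not importable from `Theorems/`; the line's local
notation `ℝ³` is spelled out as `EuclideanSpace ℝ (Fin 3)`, nothing else changes), so that the line's
stubs `stub_sliceDictionary`, `stub_accelerationBound`, `stub_annulusPressure` can be proved BY NAME with
their verbatim signatures in separate Theorems files (lead prover ns-tc-p1, DIRECTOR-NS #210 (1)).
Same namespace as the line (`…Cruxes.TypeIQuantSubcubicExp.FlatWindow`), same names, same bodies:

* `pvRegion` — the unit backward parabolic region `[−1,0) × B₁` of Pineau–Vicol 2026 Thm 1.9;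
* `pvSliceDefect u t x` — the one-slice self-similarity defect (1.17),
  `√(−t) • ((−t) ∂ₜu − ½ u − ½ Du[x])` (time derivative within `pvRegion`);
* `profileLine u y` — the time line `s ↦ U(s,y)` of the backward similarity profile
  `U = lerayOrbit u`;
* `OneSliceThreshold Cu δ₀` — the conclusion of Pineau–Vicol Thm 1.9 with explicit threshold;
* `AccelerationBound C₀ B` — `‖∂ₛ²U‖ ≤ B` in the envelope class `HasTypeIDecay C₀`;
* `AnnulusPressure C₀ Cp` — a classical pressure on `pvRegion` bounded by `Cp` on the annulus
  `{1/2 < ‖x‖ < 3/4} × [−1,0)`;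
* `SliceDictionary` — the chain rule identifying the one-slice defect with the profile velocity
  `∂ₛU(s, y)` at `s = −log(−t)`, `y = x/√(−t)`.

HONEST FRAMING: nothing is asserted here; the line is a RUNG line on the DSS wall (it does not conclude
the crux `TypeIQuantSubcubicExp`); the crux, its parent `SuperlogCubeRate` and every Navier–Stokes
statement remain unproved. No summit statement is proved.
-/

noncomputable section

-- the summit-side namespace `Summit.NavierStokesRegularity.NavierStokesRegularity.…` (single-conjunct summit,
-- D-0017) repeats a component by design; the dupNamespace linter would flag every declaration.
set_option linter.dupNamespace false

namespace Summit.NavierStokesRegularity.NavierStokesRegularity.Cruxes.TypeIQuantSubcubicExp.FlatWindow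

open MeasureTheory Set Function Filter Topology Metric
open Literature.Analysis Literature.Analysis.FluidPDE

/-! ### The objects -/

/-- The unit backward parabolic region `[−1,0) × B₁` of Pineau–Vicol Thm 1.9. [this file; verbatim from `Cruxes/TypeIQuantSubcubicExp/Lines/flat_window.lean`, `ℝ³` spelled out] -/
def pvRegion : Set (ℝ × EuclideanSpace ℝ (Fin 3)) := Ico (-1 : ℝ) 0 ×ˢ ball (0 : EuclideanSpace ℝ (Fin 3)) 1

/-- Pineau–Vicol's one-slice self-similarity defect (1.17) at `(t,x)`:
`√(−t) • ((−t) • ∂ₜu(t,x) − ½ u(t,x) − ½ Du(t,x)[x])`, time derivative within `pvRegion`. [this file; verbatim from `Cruxes/TypeIQuantSubcubicExp/Lines/flat_window.lean`, `ℝ³` spelled out] -/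
def pvSliceDefect (u : ℝ → EuclideanSpace ℝ (Fin 3) → EuclideanSpace ℝ (Fin 3)) (t : ℝ) (x : EuclideanSpace ℝ (Fin 3)) : EuclideanSpace ℝ (Fin 3) :=
  Real.sqrt (-t) •
    ((-t) • timeDerivOn pvRegion u t x - (1 / 2 : ℝ) • u t x - (1 / 2 : ℝ) • fderiv ℝ (u t) x x)

/-- The time line `s ↦ U(s,y)` of the backward similarity profile `U = lerayOrbit u` at label `y`. [this file; verbatim from `Cruxes/TypeIQuantSubcubicExp/Lines/flat_window.lean`, `ℝ³` spelled out] -/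
def profileLine (u : ℝ → EuclideanSpace ℝ (Fin 3) → EuclideanSpace ℝ (Fin 3)) (y : EuclideanSpace ℝ (Fin 3)) : ℝ → EuclideanSpace ℝ (Fin 3) := fun s => lerayOrbit u s y

/-- **One-slice threshold `δ₀` for the envelope constant `Cu`** — the conclusion of Pineau–Vicol
Thm 1.9 with the threshold made an explicit parameter (so that a window can be DISPLAYED). [this file; verbatim from `Cruxes/TypeIQuantSubcubicExp/Lines/flat_window.lean`, `ℝ³` spelled out] -/
def OneSliceThreshold (Cu δ₀ : ℝ) : Prop :=
  0 < δ₀ ∧ ∀ Cp : ℝ, 0 < Cp → ∃ s₀ : ℝ, 1 ≤ s₀ ∧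
    ∀ (u : ℝ → EuclideanSpace ℝ (Fin 3) → EuclideanSpace ℝ (Fin 3)) (p : ℝ → EuclideanSpace ℝ (Fin 3) → ℝ),
      IsClassicalNSSolutionOnRegion pvRegion 1 0 u p →
      (∀ t ∈ Ico (-1 : ℝ) 0, ∀ x ∈ ball (0 : EuclideanSpace ℝ (Fin 3)) 1, ‖u t x‖ ≤ Cu / (Real.sqrt (-t) + ‖x‖)) →
      (∀ t ∈ Ico (-1 : ℝ) 0, ∀ x : EuclideanSpace ℝ (Fin 3), 1 / 2 < ‖x‖ → ‖x‖ < 3 / 4 → |p t x| ≤ Cp) →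
      ∀ tbar : ℝ, -Real.exp (-s₀) < tbar → tbar < 0 →
        (∀ x ∈ ball (0 : EuclideanSpace ℝ (Fin 3)) 1, ‖pvSliceDefect u tbar x‖ ≤ δ₀) →
        ∃ r : ℝ, 0 < r ∧ ∃ M : ℝ, ∀ t : ℝ, -r ^ 2 < t → t < 0 → ∀ x ∈ ball (0 : EuclideanSpace ℝ (Fin 3)) r, ‖u t x‖ ≤ M

/-- **Acceleration bound `B` for the envelope constant `C₀`**: every classical ancient solution in the
Type-I envelope class `HasTypeIDecay C₀` has a `C²`-in-`s` profile with `‖∂ₛ²U(s,y)‖ ≤ B` for all `s, y`. [this file; verbatim from `Cruxes/TypeIQuantSubcubicExp/Lines/flat_window.lean`, `ℝ³` spelled out] -/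
def AccelerationBound (C₀ B : ℝ) : Prop :=
  ∀ (u : ℝ → EuclideanSpace ℝ (Fin 3) → EuclideanSpace ℝ (Fin 3)) (p : ℝ → EuclideanSpace ℝ (Fin 3) → ℝ),
    IsClassicalNSSolutionOn (Iio 0) 1 0 u p → HasTypeIDecay C₀ u →
    ∀ y : EuclideanSpace ℝ (Fin 3), ContDiff ℝ 2 (profileLine u y) ∧ ∀ s : ℝ, ‖iteratedDeriv 2 (profileLine u y) s‖ ≤ B

/-- **Annulus pressure bound `Cp` for the envelope constant `C₀`**: every classical ancient solution
in the envelope class admits a pressure `p'` (the Riesz pressure, `= p` up to a function of time) making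
`(u,p')` classical on `pvRegion` with `|p'| ≤ Cp` on `{1/2 < ‖x‖ < 3/4} × [−1,0)` (hypothesis (1.16)). [this file; verbatim from `Cruxes/TypeIQuantSubcubicExp/Lines/flat_window.lean`, `ℝ³` spelled out] -/
def AnnulusPressure (C₀ Cp : ℝ) : Prop :=
  ∀ (u : ℝ → EuclideanSpace ℝ (Fin 3) → EuclideanSpace ℝ (Fin 3)) (p : ℝ → EuclideanSpace ℝ (Fin 3) → ℝ),
    IsClassicalNSSolutionOn (Iio 0) 1 0 u p → HasTypeIDecay C₀ u →
    ∃ p' : ℝ → EuclideanSpace ℝ (Fin 3) → ℝ, IsClassicalNSSolutionOnRegion pvRegion 1 0 u p' ∧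
      ∀ t ∈ Ico (-1 : ℝ) 0, ∀ x : EuclideanSpace ℝ (Fin 3), 1 / 2 < ‖x‖ → ‖x‖ < 3 / 4 → |p' t x| ≤ Cp

/-- **The slice dictionary** (Chae–Wolf 2017 §4 / Pineau–Vicol (1.17) vs (1.12)): for a classical
solution on `(−∞,0) × EuclideanSpace ℝ (Fin 3)`, the one-slice defect at `(t,x)`, `−1 < t < 0`, `‖x‖ < 1`, IS the profile
velocity `∂ₛU(s,y)` at `s = −log(−t)`, `y = x/√(−t)`. [this file; verbatim from `Cruxes/TypeIQuantSubcubicExp/Lines/flat_window.lean`, `ℝ³` spelled out] -/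
def SliceDictionary : Prop :=
  ∀ (u : ℝ → EuclideanSpace ℝ (Fin 3) → EuclideanSpace ℝ (Fin 3)) (p : ℝ → EuclideanSpace ℝ (Fin 3) → ℝ), IsClassicalNSSolutionOn (Iio 0) 1 0 u p →
    ∀ t : ℝ, -1 < t → t < 0 → ∀ x ∈ ball (0 : EuclideanSpace ℝ (Fin 3)) 1,
      pvSliceDefect u t x = deriv (profileLine u ((Real.sqrt (-t))⁻¹ • x)) (-Real.log (-t))

end Summit.NavierStokesRegularity.NavierStokesRegularity.Cruxes.TypeIQuantSubcubicExp.FlatWindow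

end
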